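/-
Copyright: the b2b-balaban T⁴-continuum CRUX team, row NE7b OWNER lineage `t4-ne7b-p1` (gen 126). Project licence.
-/
import Summits.QuantumFields.BalabanUV.T4Continuum.Spine.NE7b.SupZdCouplingShiftColumn
import Summits.QuantumFields.BalabanUV.T4Continuum.Spine.NE7b.SupZdKernelNeumannTwoSided

/-!
# THE BLOCK COLUMNS AT A SHIFTED COUPLING, CONSTRUCTED FROM THE REFERENCE COUPLING: on `ℤ^d`, for the `H + K` column with block columns `Ψ`
# at coupling `a` (block profile `C_Ψ`, rate `μ`) and any `a′` with `|a′ − a|` small against `C_Ψ` (explicit), the resolvent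
# `R = (1 + (a′−a)T_a)⁻¹` exists as a two-sided decaying inverse ((226)'s Neumann series about the identity), `Ψ′_c := Σ′_bR(b,c)Ψ_b` has a
# block profile and solves `(H_{V,a′} + K)Ψ′_c = 𝟙_{B c}` — THE COLUMNS AT `a′` EXIST with constants EXPLICIT in the `a`-constants — with coarse
# matrix `T_{a′} = T_aR`, and a decaying left inverse `N` of `T_a` gives the left inverse `N + (a′−a)·1` of `T_{a′}`; together with (261) (the
# transfer of (U)) every input of (258)–(260) at the shifted coupling is produced from the reference coupling, so the a-uniformity audit closes
# CONSTRUCTIVELY on the window `|a′ − a| ≤ ρ(a)` (row NE7b, node U5c; (226)∕(258) + (203)∕(234) BY NAME; [folklore])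

Cell `pub-balaban`, sub-cell `t4`, spine estimate NE7b (`T4WeightBudget.RelWeightBound`; the cell's OWN estimate — NOT PRINTED in
[Bałaban 1983–89], NOT PROVED).  Crux-route work under `Spine/NE7b/` by the row OWNER (`t4-ne7b-p1` gen 126, file (262)) under FREEZE
(0)'s crux-prover clause, on § [NE7bP1-G125-HANDOFF] NEXT (3)(a); NOTHING of Bałaban's is named as a Lean object, valued or asserted; no
`T4Continuum/Support` leaf typed; no `def`, no notation (the reference columns and left inverse are ANY data with the displayed clauses —
(216)∕(222)∕(246) supply them); zero `sorry`.  Imports (BY NAME): the OWNER's (258) `…SupZdCouplingShiftColumn` (`column_superposition`;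
through it (203) `kernel_comp_apply`, (234) `coarse_entry_le`, (189) `summable_kernel_row`, (191) `natAbs_sub_comm_sum`), (226)
`…SupZdKernelNeumannTwoSided` (`two_sided_decaying_inverse`).

WHY (located).  (258)–(260) make the coupling dependence of the next-scale triple explicit but take the `a′`-column, (U) at `a′` and the
inverses at `a′` as inputs; by name those come from (216)∕(222) at coupling `a′` with smallness of `K` against the OPAQUE constants
`C₀(a′), C_P(a′), δ₀(a′)`.  This file removes that dependence: from the column identity `Ψ^a = Ψ^{a′}(1 + εT_a)` ((258) §2, `ε = a′ − a`) read
backwards, `Ψ^{a′}_c := Σ′_bR(b,c)Ψ^a_b` with `R = (1 + εT_a)⁻¹`; `R` exists in the decaying class by (226) (`T = M = δ`, `E = εT_a` of size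
`|ε|C_Ψ` at rate `μ`) under ONE explicit smallness `e^{2νd}K_1K_{μ−ν}|ε|C_Ψ ≤ 1∕2`; the superposition has a block profile and solves the
`a`-equation with the coarse datum `R(·,c)` ((258) §1), so at `a′` its source is `(R + εT_aR)(·,c)∘blk = δ_c∘blk = 𝟙_{B c}` — the
`a′`-columns, with profile constant `2e^{νd}K_1·C_Ψ·K_{μ−ν}`.  Their coarse matrix is `T_{a′} = T_aR` (block means through the series), and
`(N + ε·1)T_aR = (NT_a)R + εT_aR = (1 + εT_a)R = 1` ((203)'s re-association) — a decaying LEFT inverse at `a′`, the input of (260).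

WHAT IS PROVED ([folklore]; every mesh `n`, ANY `a, a′ : ℝ`, ANY `V`, kernel `|K(p,q)| ≤ εe^{−γ|p−q|₁}`, `0 < ν < μ`):
* §1 **`shift_resolvent`** (`∃ R`: `|R(b,c)| ≤ 2e^{νd}K_1e^{−ν|b−c|₁}`, `R(b,c) + (a′−a)Σ′_{b′}T_a(b,b′)R(b′,c) = δ_{bc}` and
  `R(b,c) + (a′−a)Σ′_{b′}R(b,b′)T_a(b′,c) = δ_{bc}`, sums absolutely convergent).
* §2 **`transferred_columns`** (`∃ R Ψ′`: §1's clauses, `Ψ′_c(p) = Σ′_bR(b,c)Ψ_b(p)` (summable), block profile at rate `ν`, the equations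
  `(H_{V,a′} + K)Ψ′_c = 𝟙_{B c}`, and the coarse matrix `(n+1)^{−d}Σ_{B b′}Ψ′_c = Σ′_bT_a(b′,b)R(b,c)`).
* §3 THE END **`transferred_left_inverse`** (for `R` with §1's first identity and a decaying `N` with `NT_a = 1`:
  `Σ′_{b′}(N(c,b′) + (a′−a)δ_{cb′})·Σ′_xT_a(b′,x)R(x,b) = δ_{cb}`).
* §4 toy.

HONEST (what this is NOT).  Neumann series about the identity + kernel algebra; the window `|a′ − a| ≤ ρ(a)` is explicit in `C_Ψ, μ, ν, d`
and shrinks with `C_Ψ`; (U) at `a′` is (261) (needs (E)+(U) at `a` and `|a′−a|C_G < 1`); the RIGHT inverse `N + ε·1` of `T_{a′}` is (259) by name;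
covering (255)'s whole window `(a(1 − (n+1)^{−d}), a]` for the small meshes needs finitely many transfers with growing constants (not done
here); scalar skeleton ((A3), NC-NE7b-α UNRULED); nothing of the torus; nothing of the covariant propagators of [B4]–[B6]; nothing of
Bałaban's asserted.  BY-NAME EFFECT ON THE WALL: NONE.  NE7b NOT PRINTED ∕ NOT PROVED; spine PROVED 0∕9; rung (B)+1 — the programme's
measures remain FINITE-torus statements; NOT the mass gap, NOT Clay.  HONEST DEPENDENCY: continuum YM on T⁴ ⇐ BetaPertH ∧ nine spine
estimates (0∕9 proved); BetaPertH ⇐ (D1) ∧ (D4) ∧ CAP+tail; G-an2-4 gates asym, D1 and NE2∕3∕4.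
-/

set_option autoImplicit false

noncomputable section

namespace Summit.QuantumFields.BalabanUV.T4Continuum.NE7b.SupZdCouplingTransferColumns

open Real Filter Topology
open Literature.MathematicalPhysics.QuantumFieldTheory.Balaban1983to89
open B6QGQLower276 (X e blk B mem_B sum_B_const)
open SupZdExponentialSums (summable_exp_l1 summable_kernel_row)
open SupZdCoarseForm (natAbs_sub_comm_sum)
open SupZdCoarseInverseOperator (kernel_comp_apply)
open SupZdPerturbedCoarseForm (coarse_entry_le)
open SupZdKernelNeumannTwoSided (two_sided_decaying_inverse)
open SupZdCouplingShiftColumn (column_superposition)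

variable {d : ℕ}

/-! ## §1. The resolvent `R = (1 + (a′−a)T_a)⁻¹` in the decaying class -/

/-- **THE RESOLVENT OF THE SHIFTED IDENTITY**: block columns `Ψ` at coupling `a` with `|Ψ_c(p)| ≤ C_Ψe^{−μ|blk p − c|₁}`, coarse matrix
`T_a(b,c) = (n+1)^{−d}Σ_{B b}Ψ_c`, `0 < ν < μ`, and the smallness `e^{νd}K_1·(|a′−a|C_Ψe^{νd}K_{μ−ν}) ≤ 1∕2` ⟹ there is `R` with
`|R(b,c)| ≤ 2e^{νd}K_1e^{−ν|b−c|₁}` and `(1 + (a′−a)T_a)R = 1 = R(1 + (a′−a)T_a)` entrywise (sums absolutely convergent) — (226) about `T = M = δ`,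
`E = (a′−a)T_a`. [folklore] -/
theorem shift_resolvent (n : ℕ) (a a' : ℝ) {μ ν CΨ : ℝ} (hν : 0 < ν) (hνμ : ν < μ)
    (Ψ : X d → X d → ℝ) (hΨd : ∀ c p, |Ψ c p| ≤ CΨ * exp (-(μ * ∑ i, (((blk n p i - c i).natAbs : ℕ) : ℝ))))
    (hsmall : (exp (ν * d) * (2 * (1 - exp (-1))⁻¹) ^ d)
      * (|a' - a| * CΨ * exp (ν * d) * (2 * (1 - exp (-(μ - ν)))⁻¹) ^ d) ≤ 1 / 2) :
    ∃ R : X d → X d → ℝ,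
      (∀ b c, |R b c| ≤ 2 * (exp (ν * d) * (2 * (1 - exp (-1))⁻¹) ^ d) * exp (-(ν * ∑ i, (((b i - c i).natAbs : ℕ) : ℝ)))) ∧
      (∀ b c, Summable (fun b' : X d => ((((n : ℝ) + 1) ^ d)⁻¹ * ∑ q ∈ B n b, Ψ b' q) * R b' c) ∧
        R b c + (a' - a) * ∑' b' : X d, ((((n : ℝ) + 1) ^ d)⁻¹ * ∑ q ∈ B n b, Ψ b' q) * R b' c = if b = c then 1 else 0) ∧
      (∀ b c, Summable (fun b' : X d => R b b' * ((((n : ℝ) + 1) ^ d)⁻¹ * ∑ q ∈ B n b', Ψ c q)) ∧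
        R b c + (a' - a) * ∑' b' : X d, R b b' * ((((n : ℝ) + 1) ^ d)⁻¹ * ∑ q ∈ B n b', Ψ c q) = if b = c then 1 else 0) := by
  classical
  have hμ : 0 < μ := hν.trans hνμ
  have hCΨ : 0 ≤ CΨ := by
    have h := (abs_nonneg _).trans (hΨd 0 0); exact le_of_mul_le_mul_right (by rw [zero_mul]; exact h) (exp_pos _)
  obtain ⟨T, hT⟩ : ∃ T : X d → X d → ℝ, ∀ b c, T b c = (((n : ℝ) + 1) ^ d)⁻¹ * ∑ q ∈ B n b, Ψ c q := ⟨_, fun _ _ => rfl⟩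
  have hTd : ∀ b c, |T b c| ≤ CΨ * exp (-(μ * ∑ i, (((b i - c i).natAbs : ℕ) : ℝ))) := fun b c => by
    rw [hT]; exact coarse_entry_le n Ψ c (hΨd c) b
  -- the identity kernel and the perturbation
  have hdec : ∀ (r : ℝ) (b c : X d), |(if b = c then (1 : ℝ) else 0)| ≤ 1 * exp (-(r * ∑ i, (((b i - c i).natAbs : ℕ) : ℝ))) := by
    intro r b c
    split_ifs with h
    · rw [h]; simp
    · rw [abs_zero]; positivity
  have hE : ∀ b c, |(a' - a) * T b c| ≤ |a' - a| * CΨ * exp (-(μ * ∑ i, (((b i - c i).natAbs : ℕ) : ℝ))) := fun b c => by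
    rw [abs_mul, mul_assoc]; exact mul_le_mul_of_nonneg_left (hTd b c) (abs_nonneg _)
  have hδδ : ∀ b c : X d, ∑' b' : X d, (if b = b' then (1 : ℝ) else 0) * (if b' = c then (1 : ℝ) else 0) = if b = c then 1 else 0 := by
    intro b c
    rw [tsum_eq_single b (fun b' hb' => by rw [if_neg (fun h => hb' h.symm), zero_mul]), if_pos rfl, one_mul]
  have hsmall' : ((1 : ℝ) * exp (ν * d) * (2 * (1 - exp (-(ν + 1 - ν)))⁻¹) ^ d)
      * (|a' - a| * CΨ * exp (ν * d) * (2 * (1 - exp (-(μ - ν)))⁻¹) ^ d) ≤ 1 / 2 := by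
    rw [one_mul, show ν + 1 - ν = (1 : ℝ) by ring]; exact hsmall
  obtain ⟨R, hRd, hright, hleft, -, -⟩ := two_sided_decaying_inverse (d := d) zero_le_one hμ zero_le_one (by positivity) hν
    (by linarith) hνμ (fun b c => if b = c then (1 : ℝ) else 0) (fun b c => if b = c then (1 : ℝ) else 0) (fun b c => (a' - a) * T b c)
    (hdec μ) (hdec (ν + 1)) hE hδδ hδδ hsmall'
  have hRd' : ∀ b c, |R b c| ≤ 2 * (exp (ν * d) * (2 * (1 - exp (-1))⁻¹) ^ d) * exp (-(ν * ∑ i, (((b i - c i).natAbs : ℕ) : ℝ))) := by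
    intro b c
    have h := hRd b c
    rw [one_mul, show ν + 1 - ν = (1 : ℝ) by ring] at h
    exact h
  have hK1 : 0 ≤ (2 * (1 - exp (-1 : ℝ))⁻¹) ^ d :=
    pow_nonneg (mul_nonneg zero_le_two (inv_nonneg.2 (sub_nonneg.2 (exp_le_one_iff.2 (by norm_num))))) d
  have hRb : ∀ b c, |R b c| ≤ 2 * (exp (ν * d) * (2 * (1 - exp (-1))⁻¹) ^ d) := fun b c =>
    (hRd' b c).trans (mul_le_of_le_one_right (by positivity) (exp_le_one_iff.2 (neg_nonpos.2 (by positivity))))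
  refine ⟨R, hRd', fun b c => ?_, fun b c => ?_⟩
  · -- right identity: `(δ + εT)R = δ`
    have hsT : Summable fun b' : X d => T b b' * R b' c := summable_kernel_row hμ T hTd (fun b' => R b' c) (fun b' => hRb b' c) b
    have hsδ : Summable fun b' : X d => (if b = b' then (1 : ℝ) else 0) * R b' c :=
      summable_of_ne_finset_zero (s := {b}) fun b' hb' => by
        rw [if_neg (fun h => hb' (Finset.mem_singleton.2 h.symm)), zero_mul]
    have e : ∀ b', ((if b = b' then (1 : ℝ) else 0) + (a' - a) * T b b') * R b' c
        = (if b = b' then (1 : ℝ) else 0) * R b' c + (a' - a) * (T b b' * R b' c) := fun b' => by ring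
    have h := (hright b c).2
    rw [tsum_congr e, hsδ.tsum_add (hsT.mul_left _), tsum_mul_left,
      tsum_eq_single b (fun b' hb' => by rw [if_neg (fun h => hb' h.symm), zero_mul]), if_pos rfl, one_mul] at h
    simp only [hT] at hsT h
    exact ⟨hsT, h⟩
  · -- left identity: `R(δ + εT) = δ`
    have hTc : ∀ b', |T b' c| ≤ CΨ * exp (-(μ * ∑ i, (((c i - b' i).natAbs : ℕ) : ℝ))) := fun b' => by
      rw [natAbs_sub_comm_sum]; exact hTd b' c
    have hTb : ∀ b', |T b' c| ≤ CΨ := fun b' =>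
      (hTc b').trans (mul_le_of_le_one_right hCΨ (exp_le_one_iff.2 (neg_nonpos.2 (by positivity))))
    have hsT : Summable fun b' : X d => R b b' * T b' c := summable_kernel_row hν R hRd' (fun b' => T b' c) hTb b
    have hsδ : Summable fun b' : X d => R b b' * (if b' = c then (1 : ℝ) else 0) :=
      summable_of_ne_finset_zero (s := {c}) fun b' hb' => by
        rw [if_neg (fun h => hb' (Finset.mem_singleton.2 h)), mul_zero]
    have e : ∀ b', R b b' * ((if b' = c then (1 : ℝ) else 0) + (a' - a) * T b' c)
        = R b b' * (if b' = c then (1 : ℝ) else 0) + (a' - a) * (R b b' * T b' c) := fun b' => by ring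
    have h := (hleft b c).2
    rw [tsum_congr e, hsδ.tsum_add (hsT.mul_left _), tsum_mul_left,
      tsum_eq_single c (fun b' hb' => by rw [if_neg hb', mul_zero]), if_pos rfl, mul_one] at h
    simp only [hT] at hsT h
    exact ⟨hsT, h⟩

/-! ## §2. The columns at the shifted coupling -/

/-- **THE BLOCK COLUMNS AT COUPLING `a′` FROM THOSE AT `a`**: under §1's smallness (and the class data), with §1's `R`, the superpositions
`Ψ′_c(p) = Σ′_bR(b,c)Ψ_b(p)` converge absolutely, have the block profile `2e^{νd}K_1·C_Ψ·K_{μ−ν}·e^{−ν|blk p − c|₁}`, solve `(H_{V,a′} + K)Ψ′_c = 𝟙_{B c}`,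
and have the coarse matrix `(n+1)^{−d}Σ_{B b′}Ψ′_c = Σ′_bT_a(b′,b)R(b,c)`. [folklore] -/
theorem transferred_columns (n : ℕ) (a a' : ℝ) {ε γ μ ν CΨ : ℝ} (hε : 0 ≤ ε) (hγ : 0 < γ) (hν : 0 < ν) (hνμ : ν < μ)
    (V : X d → ℝ) (K : X d → X d → ℝ) (hK : ∀ p q, |K p q| ≤ ε * exp (-(γ * ∑ i, (((p i - q i).natAbs : ℕ) : ℝ))))
    (Ψ : X d → X d → ℝ) (hΨd : ∀ c p, |Ψ c p| ≤ CΨ * exp (-(μ * ∑ i, (((blk n p i - c i).natAbs : ℕ) : ℝ))))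
    (hΨ : ∀ c p, ((n : ℝ) + 1) ^ 2 * ∑ μ', (2 * Ψ c p - Ψ c (p + e μ') - Ψ c (p - e μ'))
        + a / ((n : ℝ) + 1) ^ d * ∑ q ∈ B n (blk n p), Ψ c q + V p * Ψ c p + ∑' q : X d, K p q * Ψ c q
          = if blk n p = c then 1 else 0)
    (hsmall : (exp (ν * d) * (2 * (1 - exp (-1))⁻¹) ^ d)
      * (|a' - a| * CΨ * exp (ν * d) * (2 * (1 - exp (-(μ - ν)))⁻¹) ^ d) ≤ 1 / 2) :
    ∃ R Ψ' : X d → X d → ℝ,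
      (∀ b c, |R b c| ≤ 2 * (exp (ν * d) * (2 * (1 - exp (-1))⁻¹) ^ d) * exp (-(ν * ∑ i, (((b i - c i).natAbs : ℕ) : ℝ)))) ∧
      (∀ b c, Summable (fun b' : X d => ((((n : ℝ) + 1) ^ d)⁻¹ * ∑ q ∈ B n b, Ψ b' q) * R b' c) ∧
        R b c + (a' - a) * ∑' b' : X d, ((((n : ℝ) + 1) ^ d)⁻¹ * ∑ q ∈ B n b, Ψ b' q) * R b' c = if b = c then 1 else 0) ∧
      (∀ b c, Summable (fun b' : X d => R b b' * ((((n : ℝ) + 1) ^ d)⁻¹ * ∑ q ∈ B n b', Ψ c q)) ∧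
        R b c + (a' - a) * ∑' b' : X d, R b b' * ((((n : ℝ) + 1) ^ d)⁻¹ * ∑ q ∈ B n b', Ψ c q) = if b = c then 1 else 0) ∧
      (∀ c p, Summable (fun b : X d => R b c * Ψ b p) ∧ Ψ' c p = ∑' b : X d, R b c * Ψ b p) ∧
      (∀ c p, |Ψ' c p| ≤ 2 * (exp (ν * d) * (2 * (1 - exp (-1))⁻¹) ^ d) * CΨ * (2 * (1 - exp (-(μ - ν)))⁻¹) ^ d
        * exp (-(ν * ∑ i, (((blk n p i - c i).natAbs : ℕ) : ℝ)))) ∧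
      (∀ c p, ((n : ℝ) + 1) ^ 2 * ∑ μ', (2 * Ψ' c p - Ψ' c (p + e μ') - Ψ' c (p - e μ'))
        + a' / ((n : ℝ) + 1) ^ d * ∑ q ∈ B n (blk n p), Ψ' c q + V p * Ψ' c p + ∑' q : X d, K p q * Ψ' c q
          = if blk n p = c then 1 else 0) ∧
      (∀ b' c, (((n : ℝ) + 1) ^ d)⁻¹ * ∑ q ∈ B n b', Ψ' c q
        = ∑' b : X d, ((((n : ℝ) + 1) ^ d)⁻¹ * ∑ q ∈ B n b', Ψ b q) * R b c) := by
  classical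
  obtain ⟨R, hRd, hright, hleft⟩ := shift_resolvent n a a' hν hνμ Ψ hΨd hsmall
  obtain ⟨Ψ', hΨ'⟩ : ∃ Ψ' : X d → X d → ℝ, ∀ c p, Ψ' c p = ∑' b : X d, R b c * Ψ b p := ⟨_, fun _ _ => rfl⟩
  refine ⟨R, Ψ', hRd, hright, hleft, ?_⟩
  -- the superposition with coefficients `R(·, c)` ((258) §1): `Ψ` indexed by its block
  have hΨd' : ∀ b p, |Ψ b p| ≤ CΨ * exp (-(μ * ∑ i, (((blk n p i - b i).natAbs : ℕ) : ℝ))) := fun b p => hΨd b p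
  have hsup := fun c => column_superposition n a hε hγ hν hνμ V K hK Ψ hΨd' (fun b p => hΨ b p) c (fun b => R b c) (fun b => hRd b c)
  have hs : ∀ c p, Summable (fun b : X d => R b c * Ψ b p) := fun c p => (hsup c).1 p
  -- block means through the series
  have hmean : ∀ b' c, (((n : ℝ) + 1) ^ d)⁻¹ * ∑ q ∈ B n b', Ψ' c q
      = ∑' b : X d, ((((n : ℝ) + 1) ^ d)⁻¹ * ∑ q ∈ B n b', Ψ b q) * R b c := by
    intro b' c
    have e : ∀ b : X d, ((((n : ℝ) + 1) ^ d)⁻¹ * ∑ q ∈ B n b', Ψ b q) * R b c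
        = (((n : ℝ) + 1) ^ d)⁻¹ * ∑ q ∈ B n b', R b c * Ψ b q := fun b => by
      have h : ∑ q ∈ B n b', R b c * Ψ b q = R b c * ∑ q ∈ B n b', Ψ b q := by rw [← Finset.mul_sum]
      rw [h]; ring
    rw [tsum_congr e, tsum_mul_left, Summable.tsum_finsetSum (fun q _ => hs c q)]
    congr 1
    exact Finset.sum_congr rfl fun q _ => hΨ' c q
  refine ⟨fun c p => ⟨hs c p, hΨ' c p⟩, fun c p => ?_, fun c p => ?_, hmean⟩
  · rw [hΨ']; exact (hsup c).2.1 p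
  · -- the `a′`-equation: the `a`-equation gives `R(blk p, c)`, the extra `(a′−a)Π` gives `(a′−a)(T_aR)(blk p, c)`; §1 sums them to `δ`
    have hW := (hsup c).2.2 p
    simp only [← hΨ'] at hW
    have hid := (hright (blk n p) c).2
    rw [← hmean (blk n p) c] at hid
    rw [← hid, ← hW, div_eq_mul_inv, div_eq_mul_inv]
    ring

/-! ## §3. THE END: a left inverse at the shifted coupling -/

/-- **HEADLINE — `(N + (a′−a)·1)·T_{a′} = 1` FOR `T_{a′} = T_aR`.**  With `R` as in §1 (its first identity `R + (a′−a)T_aR = 1` and decay at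
rate `ν`), the coarse matrix `T_a` of the `a`-columns (decay `C_Ψ` at rate `μ`), and ANY decaying `N` with `NT_a = 1`: for all `c, b`,
`Σ′_{b′}(N(c,b′) + (a′−a)δ_{cb′})·(Σ′_xT_a(b′,x)R(x,b)) = δ_{cb}` (summable) — `(NT_a)R + (a′−a)T_aR = (1 + (a′−a)T_a)R = 1`, (203)'s
re-association; the LEFT-inverse input of (260) at the shifted coupling. [folklore] -/
theorem transferred_left_inverse (n : ℕ) (a a' : ℝ) {μ ν CΨ CR CN νN : ℝ} (hν : 0 < ν) (hνμ : ν < μ) (hνN : 0 < νN)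
    (Ψ : X d → X d → ℝ) (hΨd : ∀ c p, |Ψ c p| ≤ CΨ * exp (-(μ * ∑ i, (((blk n p i - c i).natAbs : ℕ) : ℝ))))
    (R : X d → X d → ℝ) (hRd : ∀ b c, |R b c| ≤ CR * exp (-(ν * ∑ i, (((b i - c i).natAbs : ℕ) : ℝ))))
    (hR : ∀ b c, R b c + (a' - a) * ∑' b' : X d, ((((n : ℝ) + 1) ^ d)⁻¹ * ∑ q ∈ B n b, Ψ b' q) * R b' c = if b = c then 1 else 0)
    (N : X d → X d → ℝ) (hNd : ∀ b c, |N b c| ≤ CN * exp (-(νN * ∑ i, (((b i - c i).natAbs : ℕ) : ℝ))))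
    (hNT : ∀ c b, ∑' b' : X d, N c b' * ((((n : ℝ) + 1) ^ d)⁻¹ * ∑ q ∈ B n b', Ψ b q) = if c = b then 1 else 0) (c b : X d) :
    Summable (fun b' : X d => (N c b' + (a' - a) * (if c = b' then 1 else 0))
      * ∑' x : X d, ((((n : ℝ) + 1) ^ d)⁻¹ * ∑ q ∈ B n b', Ψ x q) * R x b) ∧
    ∑' b' : X d, (N c b' + (a' - a) * (if c = b' then 1 else 0))
      * ∑' x : X d, ((((n : ℝ) + 1) ^ d)⁻¹ * ∑ q ∈ B n b', Ψ x q) * R x b = if c = b then 1 else 0 := by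
  classical
  have hμ : 0 < μ := hν.trans hνμ
  have hCR : 0 ≤ CR := by
    have h := (abs_nonneg _).trans (hRd b b); exact le_of_mul_le_mul_right (by rw [zero_mul]; exact h) (exp_pos _)
  have hCN : 0 ≤ CN := by
    have h := (abs_nonneg _).trans (hNd b b); exact le_of_mul_le_mul_right (by rw [zero_mul]; exact h) (exp_pos _)
  obtain ⟨T, hT⟩ : ∃ T : X d → X d → ℝ, ∀ b' x, T b' x = (((n : ℝ) + 1) ^ d)⁻¹ * ∑ q ∈ B n b', Ψ x q := ⟨_, fun _ _ => rfl⟩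
  have hTd : ∀ b' x, |T b' x| ≤ CΨ * exp (-(μ * ∑ i, (((b' i - x i).natAbs : ℕ) : ℝ))) := fun b' x => by
    rw [hT]; exact coarse_entry_le n Ψ x (hΨd x) b'
  have hCΨ : 0 ≤ CΨ := by
    have h := (abs_nonneg _).trans (hTd b b); exact le_of_mul_le_mul_right (by rw [zero_mul]; exact h) (exp_pos _)
  have hRb : ∀ x, |R x b| ≤ CR := fun x =>
    (hRd x b).trans (mul_le_of_le_one_right hCR (exp_le_one_iff.2 (neg_nonpos.2 (by positivity))))
  -- the composed kernel `J(b′) = Σ′_xT(b′,x)R(x,b)` is bounded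
  have hJb : ∀ b', |∑' x : X d, T b' x * R x b| ≤ CΨ * (2 * (1 - exp (-μ))⁻¹) ^ d * CR := fun b' =>
    SupZdExponentialSums.tsum_kernel_row_le hμ T hTd (fun x => R x b) hRb b'
  -- re-association: `Σ′_{b′}N(c,b′)J(b′) = Σ′_x(NT)(c,x)R(x,b) = R(c,b)`
  have hassoc : ∑' b' : X d, N c b' * ∑' x : X d, T b' x * R x b = R c b := by
    rw [kernel_comp_apply hνN hμ N T hNd hTd (fun x => R x b) hRb c]
    have e : ∀ x, (∑' b' : X d, N c b' * T b' x) * R x b = (if c = x then 1 else 0) * R x b := fun x => by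
      simp only [hT]; rw [hNT c x]
    rw [tsum_congr e, tsum_eq_single c (fun x hx => by rw [if_neg (Ne.symm hx), zero_mul]), if_pos rfl, one_mul]
  -- summabilities
  have hs1 : Summable fun b' : X d => N c b' * ∑' x : X d, T b' x * R x b :=
    summable_kernel_row hνN N hNd _ hJb c
  have hδ0 : ∀ b', b' ≠ c → ((a' - a) * (if c = b' then (1 : ℝ) else 0)) * ∑' x : X d, T b' x * R x b = 0 := fun b' hb' => by
    rw [if_neg (Ne.symm hb'), mul_zero, zero_mul]
  have hs2 : Summable fun b' : X d => ((a' - a) * (if c = b' then (1 : ℝ) else 0)) * ∑' x : X d, T b' x * R x b :=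
    summable_of_ne_finset_zero (s := {c}) fun b' hb' => hδ0 b' (fun h => hb' (Finset.mem_singleton.2 h))
  have e : ∀ b', (N c b' + (a' - a) * (if c = b' then 1 else 0)) * ∑' x : X d, T b' x * R x b
      = N c b' * ∑' x : X d, T b' x * R x b + ((a' - a) * (if c = b' then (1 : ℝ) else 0)) * ∑' x : X d, T b' x * R x b :=
    fun b' => by ring
  have hRid := hR c b
  simp only [hT] at hs1 hs2 e hδ0 hassoc
  refine ⟨(hs1.add hs2).congr fun b' => (e b').symm, ?_⟩
  rw [tsum_congr e, hs1.tsum_add hs2, hassoc, tsum_eq_single c hδ0, if_pos rfl, mul_one]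
  exact hRid

/-! ## §4. Toy -/

/-- Toy (`d = 1`): §1's smallness condition is met for `a′ = a` (the perturbation vanishes), whatever the profile constant. -/
example (a : ℝ) (CΨ ν μ : ℝ) :
    (exp (ν * (1 : ℕ)) * (2 * (1 - exp (-1))⁻¹) ^ 1) * (|a - a| * CΨ * exp (ν * (1 : ℕ)) * (2 * (1 - exp (-(μ - ν)))⁻¹) ^ 1) ≤ 1 / 2 := by
  rw [sub_self, abs_zero, zero_mul, zero_mul, zero_mul, mul_zero]; norm_num

end Summit.QuantumFields.BalabanUV.T4Continuum.NE7b.SupZdCouplingTransferColumns
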